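import Literature.NumberTheory.EllipticCurves.ComplexMultiplication
import Literature.NumberTheory.EllipticCurves.MordellWeilTheoremProofs
import Literature.NumberTheory.EllipticCurves.MordellWeilRankZeroProofs
import HarnessLib

/-!
# The CM case of BSD in analytic rank zero — proofs: `E(ℚ)` finite ⇔ Coates–Wiles, Theorem 1

`ComplexMultiplication.lean` vendors Coates–Wiles, *On the conjecture of Birch and
Swinnerton-Dyer*, Invent. Math. 39 (1977), Theorem 1 (case `F = ℚ`) in its printed form
`Literature.NumberTheory.EllipticCurves.CoatesWiles1977_L_one_eq_zero_of_not_isOfFinAddOrder` (*"if `E(ℚ)` has a point of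
infinite order then `L(E/ℚ, 1) = 0`"*, p. 223 with §6, p. 250) and proves the reduction
`Literature.NumberTheory.EllipticCurves.finite_point_of_j_mem_maximalCMJInvariants_of_L_one_ne_zero_of_facts` of the fact
**bsd.S28** `Literature.NumberTheory.EllipticCurves.finite_point_of_j_mem_maximalCMJInvariants_of_L_one_ne_zero`
(*"`L(E,1) ≠ 0 ⇒ E(ℚ)` finite"* for CM by a maximal order) to that printed theorem plus the
Mordell–Weil theorem over `ℚ` (`WeierstrassCurve.module_finite_point`).

The Mordell–Weil theorem is proved in `MordellWeilTheoremProofs.lean`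
(`WeierstrassCurve.module_finite_point_holds`, Silverman AEC Thm. VIII.6.7). Feeding it in, this
file records that the vendored fact and the printed theorem are **equivalent**:

* `finite_point_of_j_mem_maximalCMJInvariants_of_L_one_ne_zero_of_CoatesWiles1977`:
  Coates–Wiles Thm 1 (printed form) ⇒ bsd.S28 (Mordell–Weil part), unconditionally;
* `CoatesWiles1977_L_one_eq_zero_of_not_isOfFinAddOrder_of_finite_point`: the converse
  (elementary: a point of infinite order makes `E(ℚ)` infinite);
* `finite_point_of_j_mem_maximalCMJInvariants_of_L_one_ne_zero_iff_CoatesWiles1977`: the `↔`.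

So discharging `finite_point_of_j_mem_maximalCMJInvariants_of_L_one_ne_zero` is now *exactly*
the task of proving Coates–Wiles' Theorem 1 for `F = ℚ` (Deuring's `L(E/ℚ, s) = L(ψ̄, s)`,
elliptic units, local and global class field theory in the tower `K(E_{π^{n+1}})`, CW Thms 29,
31, 34 and Lemma 35), none of which is in Mathlib v4.32.0 or Literature; it stays a named fact.

This is a proofs-only companion file (no new definitions or facts); it imports the heavy
Mordell–Weil proof chain, which `ComplexMultiplication.lean` itself deliberately does not.

The last section feeds the proved Mordell–Weil theorem into the `HasCM` forms as well
(`ComplexMultiplication.lean`, Proofs III): `finite_point_of_hasCM_of_L_one_ne_zero` and the BSD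
rank formula `bsdRankFormula_of_hasCM_of_L_one_ne_zero` (bsd.S28, geometric-CM form) then follow
from exactly three named facts, each a single printed statement — Coates–Wiles Thm 1 as printed,
the `ℚ`-isogeny to a curve with CM by the maximal order
(`exists_isIsogenous_j_mem_maximalCMJInvariants_of_hasCM`, Silverman, *Advanced Topics*,
Exercise 2.12(b)) and the isogeny invariance of `L(E,s)` (`LFunction_eq_of_isIsogenous`, Knapp,
*Elliptic Curves*, Thm. 11.67):
`finite_point_of_hasCM_of_L_one_ne_zero_of_CoatesWiles1977`,
`bsdRankFormula_of_hasCM_of_L_one_ne_zero_of_CoatesWiles1977`,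
`mordellWeilRank_eq_zero_of_hasCM_of_L_one_ne_zero`.

Finally, with `rank_ℤ E(ℚ) = 0 ↔ E(ℚ)` finite proved
(`WeierstrassCurve.mordellWeilRank_eq_zero_iff_finite`, `MordellWeilRankZeroProofs.lean`, from the
Mordell–Weil theorem and the structure theorem), the two geometric-CM rank-zero facts of
`ComplexMultiplication.lean` are **one statement**:
`bsdRankFormula_of_hasCM_of_L_one_ne_zero_iff_finite_point :
  bsdRankFormula_of_hasCM_of_L_one_ne_zero ↔ finite_point_of_hasCM_of_L_one_ne_zero`
(the direction `←` is the rank-zero glue `bsdRankFormula_of_hasCM_of_L_one_ne_zero_of_finite_point`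
of `ComplexMultiplication.lean`; `→` is `finite_point_of_hasCM_of_L_one_ne_zero_of_bsdRankFormula`
below). So the rank formula `bsdRankFormula_of_hasCM_of_L_one_ne_zero` is not an independent leaf
of the Coates–Wiles reduction: it is discharged by the one-line
`bsdRankFormula_of_hasCM_of_L_one_ne_zero_of_finite_point finite_point_of_hasCM_of_L_one_ne_zero_holds`
as soon as the finiteness fact is, and needs no decomposition of its own (its printed leaves are
those of `finite_point_of_hasCM_of_L_one_ne_zero`, see
`ComplexMultiplicationHasCMTwoLeavesProofs.lean`).

## References

* J. Coates, A. Wiles, *On the conjecture of Birch and Swinnerton-Dyer*, Invent. Math. 39 (1977),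
  223–251, Theorem 1 (p. 223) and §6 (pp. 249–251). [CoatesWiles1977]
* J. H. Silverman, *The Arithmetic of Elliptic Curves*, 2nd ed., GTM 106 (2009), Thm. VIII.6.7.
  [SilvermanAEC2009]
* J. H. Silverman, *Advanced Topics in the Arithmetic of Elliptic Curves*, GTM 151 (1994),
  Ch. II, Exercise 2.12(b) and App. A §3. [SilvermanAdvancedTopics1994]
* A. W. Knapp, *Elliptic Curves*, Mathematical Notes 40, Princeton (1992), Thm. 11.67. [Knapp1993]
-/

noncomputable section

open scoped Classical

open WeierstrassCurve

namespace Literature.NumberTheory.EllipticCurves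

/-- **bsd.S28 (Mordell–Weil part) from Coates–Wiles, Theorem 1.** If `E/ℚ` has complex
multiplication by the maximal order of a class-number-one imaginary quadratic field
(`j(E) ∈ maximalCMJInvariants`) and `L(E,1) ≠ 0`, then `E(ℚ)` is finite — deduced from the
printed Theorem 1 of Coates–Wiles (hypothesis `h`, the named fact
`CoatesWiles1977_L_one_eq_zero_of_not_isOfFinAddOrder`) and the Mordell–Weil theorem, now the
proved `WeierstrassCurve.module_finite_point_holds`: `E(ℚ)` is finitely generated and, by `h`,
torsion, hence finite. This is how the introduction of Coates–Wiles (p. 223) reads Theorem 1.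
[cite: CoatesWiles1977, Thm 1 (p. 223)] [cite: SilvermanAEC2009, Thm. VIII.6.7] -/
theorem finite_point_of_j_mem_maximalCMJInvariants_of_L_one_ne_zero_of_CoatesWiles1977
    (h : CoatesWiles1977_L_one_eq_zero_of_not_isOfFinAddOrder) :
    finite_point_of_j_mem_maximalCMJInvariants_of_L_one_ne_zero :=
  finite_point_of_j_mem_maximalCMJInvariants_of_L_one_ne_zero_of_facts
    (fun W _ => W.module_finite_point_holds) h

/-- **Converse: bsd.S28 (Mordell–Weil part) implies Coates–Wiles, Theorem 1 (`F = ℚ`).** If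
`L(E,1) ≠ 0` forces `E(ℚ)` to be finite (hypothesis `h`, the named fact
`finite_point_of_j_mem_maximalCMJInvariants_of_L_one_ne_zero`), then a rational point of
infinite order forces `L(E/ℚ, 1) = 0`: otherwise `E(ℚ)` would be a finite group containing an
element of infinite order (`isOfFinAddOrder_of_finite`). Elementary; no Mordell–Weil needed.
[cite: CoatesWiles1977, Thm 1 (p. 223)] -/
theorem CoatesWiles1977_L_one_eq_zero_of_not_isOfFinAddOrder_of_finite_point
    (h : finite_point_of_j_mem_maximalCMJInvariants_of_L_one_ne_zero) :
    CoatesWiles1977_L_one_eq_zero_of_not_isOfFinAddOrder := by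
  intro W _ hj P hP
  by_contra hL
  haveI : Finite W.toAffine.Point := h W hj hL
  exact hP (isOfFinAddOrder_of_finite P)

/-- **bsd.S28 (Mordell–Weil part) ⇔ Coates–Wiles, Theorem 1 (`F = ℚ`, printed form).** With the
Mordell–Weil theorem proved (`WeierstrassCurve.module_finite_point_holds`), the vendored fact
`finite_point_of_j_mem_maximalCMJInvariants_of_L_one_ne_zero` ("`L(E,1) ≠ 0 ⇒ E(ℚ)` finite",
CM by a maximal order) is equivalent to the theorem as Coates–Wiles print and prove it ("a point
of infinite order in `E(ℚ)` ⇒ `L(E/ℚ,1) = 0`", Thm 1, p. 223; §6, p. 250).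
[cite: CoatesWiles1977, Thm 1 (p. 223)] [cite: SilvermanAEC2009, Thm. VIII.6.7] -/
theorem finite_point_of_j_mem_maximalCMJInvariants_of_L_one_ne_zero_iff_CoatesWiles1977 :
    finite_point_of_j_mem_maximalCMJInvariants_of_L_one_ne_zero ↔
      CoatesWiles1977_L_one_eq_zero_of_not_isOfFinAddOrder :=
  ⟨CoatesWiles1977_L_one_eq_zero_of_not_isOfFinAddOrder_of_finite_point,
    finite_point_of_j_mem_maximalCMJInvariants_of_L_one_ne_zero_of_CoatesWiles1977⟩

/-- **The rank form, unconditionally in Mordell–Weil.** Under Coates–Wiles' Theorem 1 (printed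
form, hypothesis `h`): if `j(E) ∈ maximalCMJInvariants` and `L(E,1) ≠ 0` then the Mordell–Weil
rank `rank_ℤ E(ℚ)` is `0` (a finite group has `finrank ℤ = 0`). Coates–Wiles, Invent. Math. 39
(1977), Thm 1 (contrapositive of "`g_ℚ ≥ 1 ⇒ L(E/ℚ,1) = 0`").
[cite: CoatesWiles1977, Thm 1 (p. 223)] -/
theorem mordellWeilRank_eq_zero_of_j_mem_maximalCMJInvariants_of_L_one_ne_zero
    (h : CoatesWiles1977_L_one_eq_zero_of_not_isOfFinAddOrder)
    (W : WeierstrassCurve ℚ) [W.IsElliptic] (hj : W.j ∈ maximalCMJInvariants)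
    (hL : W.entireLFunction 1 ≠ 0) : W.mordellWeilRank = 0 := by
  by_contra hr
  have h1 : 1 ≤ W.mordellWeilRank := Nat.one_le_iff_ne_zero.mpr hr
  exact hL (CoatesWiles1977_L_one_eq_zero_of_one_le_mordellWeilRank h W hj h1)

/-! ### The `HasCM` forms with Mordell–Weil discharged

`ComplexMultiplication.lean` (Proofs III) reduces the geometric-CM statements
`finite_point_of_hasCM_of_L_one_ne_zero` and `bsdRankFormula_of_hasCM_of_L_one_ne_zero` to four
named facts: the Mordell–Weil theorem over `ℚ` (`hMW`), Coates–Wiles' Theorem 1 as printed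
(`hCW`), the `ℚ`-isogeny from a CM curve to one with CM by the maximal order
(`exists_isIsogenous_j_mem_maximalCMJInvariants_of_hasCM`, `hR1`) and the isogeny invariance of
the L-function (`LFunction_eq_of_isIsogenous`, `hR2`)
(`bsdRankFormula_of_hasCM_of_L_one_ne_zero_of_printed_sources`). With Mordell–Weil proved
(`WeierstrassCurve.module_finite_point_holds`) three printed inputs remain. -/

/-- **bsd.S28 (Mordell–Weil part, `HasCM` form) from Coates–Wiles Thm 1, Silverman *AT*
Ex. 2.12(b) and Knapp 11.67.** For an elliptic curve `E/ℚ` with (geometric) complex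
multiplication and `L(E,1) ≠ 0`, `E(ℚ)` is finite — assuming Coates–Wiles' Theorem 1 as printed
(`hCW`), the `ℚ`-isogeny to a curve with CM by `𝓞_K` (`hR1`) and the isogeny invariance of
`L(E,s)` (`hR2`); the Mordell–Weil theorem (`WeierstrassCurve.module_finite_point_holds`) and the
isogeny invariance of finiteness (`finite_point_of_isIsogenous`) are proved.
Coates–Wiles, Invent. Math. 39 (1977), Thm 1 (p. 223); Arthaud (1978); Rubin (1981).
[cite: CoatesWiles1977, Thm 1 (p. 223)] [cite: SilvermanAdvancedTopics1994, Exercise 2.12(b)]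
[cite: Knapp1993, Thm. 11.67] -/
theorem finite_point_of_hasCM_of_L_one_ne_zero_of_CoatesWiles1977
    (hCW : CoatesWiles1977_L_one_eq_zero_of_not_isOfFinAddOrder)
    (hR1 : exists_isIsogenous_j_mem_maximalCMJInvariants_of_hasCM)
    (hR2 : LFunction_eq_of_isIsogenous) :
    finite_point_of_hasCM_of_L_one_ne_zero :=
  finite_point_of_hasCM_of_L_one_ne_zero_of_facts
    (finite_point_of_j_mem_maximalCMJInvariants_of_L_one_ne_zero_of_CoatesWiles1977 hCW) hR1 hR2

/-- **bsd.S28, BSD rank formula in the CM analytic-rank-zero case, from its three printed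
inputs.** The named fact `bsdRankFormula_of_hasCM_of_L_one_ne_zero` (`r_an(E) = rank_ℤ E(ℚ)`,
both `0`, for `E/ℚ` with complex multiplication and `L(E,1) ≠ 0`) follows sorry-free from
Coates–Wiles' Theorem 1 as printed (`hCW`), Silverman, *Advanced Topics*, Exercise 2.12(b)
(`hR1`) and Knapp, *Elliptic Curves*, Thm. 11.67 (`hR2`); everything else — the Mordell–Weil
theorem, `L(E,1) ≠ 0 ⇒ r_an = 0`, `E(ℚ)` finite `⇒` rank `0`, and the isogeny invariance of the
finiteness of `E(ℚ)` — is proved in this library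
(`bsdRankFormula_of_hasCM_of_L_one_ne_zero_of_printed_sources` fed with
`WeierstrassCurve.module_finite_point_holds`). Coates–Wiles, Invent. Math. 39 (1977), Thm 1
(contrapositive: `g_ℚ ≥ 1 ⇒ L(E/ℚ,1) = 0`); Tate, Invent. Math. 23 (1974), Conj. 4(a).
[cite: CoatesWiles1977, Thm 1 (rank-zero consequence)]
[cite: SilvermanAdvancedTopics1994, Exercise 2.12(b)] [cite: Knapp1993, Thm. 11.67] -/
theorem bsdRankFormula_of_hasCM_of_L_one_ne_zero_of_CoatesWiles1977
    (hCW : CoatesWiles1977_L_one_eq_zero_of_not_isOfFinAddOrder)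
    (hR1 : exists_isIsogenous_j_mem_maximalCMJInvariants_of_hasCM)
    (hR2 : LFunction_eq_of_isIsogenous) :
    bsdRankFormula_of_hasCM_of_L_one_ne_zero :=
  bsdRankFormula_of_hasCM_of_L_one_ne_zero_of_printed_sources
    (fun W _ => W.module_finite_point_holds) hCW hR1 hR2

/-- **The rank form for geometric CM.** Under the same three printed inputs, an elliptic curve
`E/ℚ` with complex multiplication and `L(E,1) ≠ 0` has Mordell–Weil rank `rank_ℤ E(ℚ) = 0`
(`E(ℚ)` is finite by `finite_point_of_hasCM_of_L_one_ne_zero_of_CoatesWiles1977`, and a finite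
group has `finrank ℤ = 0`, `mordellWeilRank_eq_zero_of_finite`). Coates–Wiles, Invent. Math. 39
(1977), Thm 1 with the isogeny reduction; Rubin, Invent. Math. 64 (1981).
[cite: CoatesWiles1977, Thm 1 (rank-zero consequence)]
[cite: SilvermanAdvancedTopics1994, Exercise 2.12(b)] [cite: Knapp1993, Thm. 11.67] -/
theorem mordellWeilRank_eq_zero_of_hasCM_of_L_one_ne_zero
    (hCW : CoatesWiles1977_L_one_eq_zero_of_not_isOfFinAddOrder)
    (hR1 : exists_isIsogenous_j_mem_maximalCMJInvariants_of_hasCM)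
    (hR2 : LFunction_eq_of_isIsogenous)
    (W : WeierstrassCurve ℚ) [W.IsElliptic] (hCM : W.HasCM) (hL : W.entireLFunction 1 ≠ 0) :
    W.mordellWeilRank = 0 :=
  mordellWeilRank_eq_zero_of_finite W
    (finite_point_of_hasCM_of_L_one_ne_zero_of_CoatesWiles1977 hCW hR1 hR2 W hCM hL)

/-! ### The rank formula and the finiteness of `E(ℚ)` are the same fact

With the Mordell–Weil theorem proved, `rank_ℤ E(ℚ) = 0 ↔ E(ℚ)` finite
(`WeierstrassCurve.mordellWeilRank_eq_zero_iff_finite`, `MordellWeilRankZeroProofs.lean`), and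
`L(E,1) ≠ 0 ⇒ r_an(E) = 0` holds unconditionally
(`analyticRank_eq_zero_of_entireLFunction_one_ne_zero`). Hence the two bsd.S28 named facts
`bsdRankFormula_of_hasCM_of_L_one_ne_zero` (`r_an(E) = rank_ℤ E(ℚ)`) and
`finite_point_of_hasCM_of_L_one_ne_zero` (`E(ℚ)` finite), which carry the same hypotheses
(`E/ℚ` with geometric CM, `L(E,1) ≠ 0`), are equivalent. This is how Coates–Wiles read their
Theorem 1 (Invent. Math. 39 (1977), Introduction, p. 223: *"By the Mordell–Weil theorem, the
group `E(F)` of points of `E` with coordinates in `F` is finitely generated, and we write `g_F`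
for the rank of `E(F)` modulo torsion"*; Thm 1: `g_F ≥ 1 ⇒ L(E/F, 1) = 0`): `L(E/ℚ, 1) ≠ 0`
gives `g_ℚ = 0`, i.e. `E(ℚ)` finite. -/

/-- **bsd.S28, rank form ⇒ Mordell–Weil form.** If the BSD rank formula `r_an(E) = rank_ℤ E(ℚ)`
holds for every elliptic curve `E/ℚ` with complex multiplication and `L(E,1) ≠ 0` (hypothesis
`h`, the named fact `bsdRankFormula_of_hasCM_of_L_one_ne_zero`), then `E(ℚ)` is finite for every
such `E`: `r_an(E) = 0` unconditionally (`analyticRank_eq_zero_of_entireLFunction_one_ne_zero`),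
so `rank_ℤ E(ℚ) = 0`, and over a number field a Mordell–Weil group of rank `0` is finite
(Mordell–Weil, Silverman *AEC* Thm. VIII.6.7 with the structure theorem, proved as
`WeierstrassCurve.mordellWeilRank_eq_zero_iff_finite`). Coates–Wiles, Invent. Math. 39 (1977),
Introduction and Thm 1 (p. 223). [cite: CoatesWiles1977, Thm 1 (p. 223)]
[cite: SilvermanAEC2009, Thm. VIII.6.7] -/
theorem finite_point_of_hasCM_of_L_one_ne_zero_of_bsdRankFormula
    (h : bsdRankFormula_of_hasCM_of_L_one_ne_zero) :
    finite_point_of_hasCM_of_L_one_ne_zero := by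
  intro W _ hCM hL
  have hr : W.analyticRank = W.mordellWeilRank := h W hCM hL
  rw [analyticRank_eq_zero_of_entireLFunction_one_ne_zero W hL] at hr
  exact W.mordellWeilRank_eq_zero_iff_finite.mp hr.symm

/-- **The two geometric-CM rank-zero facts of bsd.S28 are equivalent**: the BSD rank formula
for CM elliptic curves `E/ℚ` with `L(E,1) ≠ 0` (`bsdRankFormula_of_hasCM_of_L_one_ne_zero`)
holds if and only if `E(ℚ)` is finite for all such `E` (`finite_point_of_hasCM_of_L_one_ne_zero`,
Coates–Wiles / Arthaud / Rubin). `→` is `finite_point_of_hasCM_of_L_one_ne_zero_of_bsdRankFormula`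
(Mordell–Weil, proved); `←` is the rank-zero glue
`bsdRankFormula_of_hasCM_of_L_one_ne_zero_of_finite_point` (`ComplexMultiplication.lean`).
Consequently `bsdRankFormula_of_hasCM_of_L_one_ne_zero` has exactly the printed leaves of
`finite_point_of_hasCM_of_L_one_ne_zero` and is discharged, once the latter is, by
`bsdRankFormula_of_hasCM_of_L_one_ne_zero_of_finite_point finite_point_of_hasCM_of_L_one_ne_zero_holds`.
Coates–Wiles, Invent. Math. 39 (1977), Thm 1 (p. 223), read against the Mordell–Weil theorem as
in the paper's Introduction. [cite: CoatesWiles1977, Thm 1 (p. 223)]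
[cite: SilvermanAEC2009, Thm. VIII.6.7] -/
theorem bsdRankFormula_of_hasCM_of_L_one_ne_zero_iff_finite_point :
    bsdRankFormula_of_hasCM_of_L_one_ne_zero ↔ finite_point_of_hasCM_of_L_one_ne_zero :=
  ⟨finite_point_of_hasCM_of_L_one_ne_zero_of_bsdRankFormula,
    bsdRankFormula_of_hasCM_of_L_one_ne_zero_of_finite_point⟩

/-- **The rank of a CM curve with `L(E,1) ≠ 0` is zero iff `E(ℚ)` is finite** (pointwise form of
the previous equivalence, no Coates–Wiles input): for an elliptic curve `E/ℚ` with
`L(E,1) ≠ 0`, `W.BSDRankFormula ↔ Finite E(ℚ)`, since `r_an(E) = 0` unconditionally and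
`rank_ℤ E(ℚ) = 0 ↔ E(ℚ)` finite by Mordell–Weil (`WeierstrassCurve.mordellWeilRank_eq_zero_iff_finite`).
Silverman *AEC* Thm. VIII.6.7; Birch–Swinnerton-Dyer (1965) for `ord_{s=1} L`.
[cite: SilvermanAEC2009, Thm. VIII.6.7] -/
theorem bsdRankFormula_iff_finite_point_of_entireLFunction_one_ne_zero (W : WeierstrassCurve ℚ)
    [W.IsElliptic] (hL : W.entireLFunction 1 ≠ 0) : W.BSDRankFormula ↔ Finite W.toAffine.Point := by
  rw [← W.mordellWeilRank_eq_zero_iff_finite]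
  unfold WeierstrassCurve.BSDRankFormula
  rw [analyticRank_eq_zero_of_entireLFunction_one_ne_zero W hL]
  exact eq_comm

end Literature.NumberTheory.EllipticCurves
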